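import Literature.MathematicalPhysics.QuantumFieldTheory.Balaban1983to89.T4HistoryLipschitzWitness

/-!
# NE9RecursionFunctional — the STRUCTURE leaves `ScaleZeroFree` / `Factorises` / prefix dependence of the NE9-P2 skeleton
PROVED for every functional DEFINED BY THE RG RECURSION from (scale-0 data, a local channel, a new-term map), and the
UNIQUENESS of such a functional (cell `pub-balaban`, T4-DAG §2 node U3 / §6 NE9; lineage t4-ne9-p2 = prover P2 «inductive
route», generation 19; task F1 of the ROUND-2 skeleton `HOME/t4/skeletons/NE9-t4-ne9-p2.md` §4 — leaves L01/L04)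

HONEST FRAMING (T4-DAG PAGE 1).  Rung (B)+1 on a FIXED finite torus — NOT infinite volume, NOT a mass gap, NOT the Clay problem.
NE9 (`T4OutputRate.NE9` ∧ `FadingMemory`) is a cell NEW ESTIMATE, NOT PRINTED, and is NOT discharged here.  Everything below is
kernel bookkeeping over the ABSTRACT carriers of `T4OutputRate`; no analytic input occurs.  [I] = [Balaban1987RG1] is quoted for
TYPES only (ABSOLUTE RULE): (0.23) p. 256 «𝐄_k(U_k) = Σ_{j=1}^{k} [−β_j(g_{j−1})A^η(U_k) + 𝐄^{(j)}(U_k)]» (terms fixed at birth,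
nothing before the first step), «The function 𝐄_k depends also on the effective coupling constants g_0, …, g_{k−1}.» p. 256,
(2.13) p. 268 «𝐄^{(k+1)}(g_k, U_{k+1}) = log ∫ dμ_{C^{(k)}}(B)χ_k exp[𝐏^{(k)}(g_k, U_{k+1}, B) + {...}]» (the new term = a map of the
last coupling and of the old action).  `FlowStep.BetaPertH`, (B), (B^μ) do not occur.

WHERE THIS SITS.  The lineage's end-to-end theorems display two STRUCTURE binders about the functional `E : Functional C Bg`:
`ScaleZeroFree E W` (scale-0 values history-free) and `Factorises E W T Ψ` (on creation step k+1, `E g U X = Ψ k (g k) (T k g (E g))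
U X`).  For Bałaban's terms these are not hypotheses but the DEFINITION of the family by the recursion (0.23)/(2.13).  THIS LEAF
makes that precise generically: from `base : Bg → C.Dom → ℝ` (scale-0 data), a channel `T` and a new-term map `Ψ` it DEFINES
`recE base T Ψ : Functional C Bg` by recursion on the creation step (through the truncated collections `truncRec … g n` =
«the action after n steps») and PROVES `ScaleZeroFree`, `Factorises` (given locality of the channel: it reads only
`truncScale k`), PREFIX DEPENDENCE `T4OutputRate.PrefixDependenceOn` (given causality of the channel in the comparison history:
step k reads `s_0, …, s_k` only — print: only `s_k`), and UNIQUENESS: any functional with `Factorises`, the same scale-0 data and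
a local channel IS `recE` on the window.  So leaves L01/L04 are DISCHARGED BY CONSTRUCTION for every instantiation that defines
its terms by the recursion, and the END's `E` is determined by (base, T, Ψ).  DISGUISE TEST: identities only; no inequality.

WHAT IS PROVED (kernel, `[folklore]`; 0 sorry).
§1 `truncRec`, `recE` (defs); `truncRec_of_lt` (vanishing above the truncation level), `truncRec_mono` (stability below it),
   `recE_eq_truncRec`, `truncScale_recE`, `recE_zero`, `recE_succ`.
§2 `scaleZeroFree_recE`; **`factorises_recE`** (locality for all collections) and `factorises_recE_of_channelLocal` (the
   lineage's `ChannelLocal Adm T` + admissibility); **`prefixDependenceOn_recE`** (causal channel).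
§3 **`eq_recE_of_factorises`** (uniqueness on the window) and `truncScale_eq_truncRec_of_factorises`.
§4 NON-VACUITY: the tree witness `T4HistoryLipschitzWitness.wE` IS `recE 0 wT wΨ` (`wE_eq_recE`; its channel is local:
   `wT_local`).

References (TYPES only): [Balaban1987RG1] CMP 109 (1987) (0.23) p. 256, (2.12)–(2.13) p. 268; [Balaban1988RG2Cluster] CMP 116
(1988) (1.33) p. 9 (the channel reads the action after k steps).
-/

noncomputable section

namespace Summit.QuantumFields.BalabanUV.T4Continuum.NE9RecursionFunctional

open scoped BigOperators
open Literature.MathematicalPhysics.QuantumFieldTheory.Balaban1983to89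
open Literature.MathematicalPhysics.QuantumFieldTheory.Balaban1983to89.T4OutputRate
open Literature.MathematicalPhysics.QuantumFieldTheory.Balaban1983to89.T4HistoryLipschitzRecursion
open Literature.MathematicalPhysics.QuantumFieldTheory.Balaban1983to89.T4HistoryLipschitzOuter
open Literature.MathematicalPhysics.QuantumFieldTheory.Balaban1983to89.T4HistoryLipschitzCubeGeometry
open Literature.MathematicalPhysics.QuantumFieldTheory.Balaban1983to89.T4HistoryLipschitzWitness

variable {C : Carriers} {Bg ι : Type}

/-! ## §1 The recursion -/

/-- **THE ACTION AFTER `n` STEPS of history `g`** (the truncated term collection, by recursion on `n`): at level 0 the scale-0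
data (history-free); at level n+1 the level-n collection below creation step n+1, and ON creation step n+1 the NEW TERM = the
new-term map at the last coupling `g n` and the step-n channel output of the level-n collection — the FORM of [I] (0.23) p. 256
and (2.13) p. 268.  Zero above the level. [cite: Balaban1987RG1, (0.23) p.256 and (2.13) p.268] -/
def truncRec (base : Bg → C.Dom → ℝ) (T : ℕ → (ℕ → ℝ) → (Bg → C.Dom → ℝ) → ι → ℝ)
    (Ψ : ℕ → ℝ → (ι → ℝ) → Bg → C.Dom → ℝ) (g : ℕ → ℝ) : ℕ → (Bg → C.Dom → ℝ)
  | 0 => fun U X => if C.scale X = 0 then base U X else 0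
  | n + 1 => fun U X =>
      if C.scale X ≤ n then truncRec base T Ψ g n U X
      else if C.scale X = n + 1 then Ψ n (g n) (T n g (truncRec base T Ψ g n)) U X else 0

/-- **THE RECURSION-DEFINED FUNCTIONAL**: the term of creation step `scale X` of history `g`, read off the action after
`scale X` steps. [cite: Balaban1987RG1, (0.23) p.256] -/
def recE (base : Bg → C.Dom → ℝ) (T : ℕ → (ℕ → ℝ) → (Bg → C.Dom → ℝ) → ι → ℝ)
    (Ψ : ℕ → ℝ → (ι → ℝ) → Bg → C.Dom → ℝ) : Functional C Bg :=
  fun g U X => truncRec base T Ψ g (C.scale X) U X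

variable {base : Bg → C.Dom → ℝ} {T : ℕ → (ℕ → ℝ) → (Bg → C.Dom → ℝ) → ι → ℝ}
  {Ψ : ℕ → ℝ → (ι → ℝ) → Bg → C.Dom → ℝ}

/-- Level 0, unfolded. [folklore] -/
theorem truncRec_zero (g : ℕ → ℝ) (U : Bg) (X : C.Dom) :
    truncRec base T Ψ g 0 U X = if C.scale X = 0 then base U X else 0 := rfl

/-- Level n+1, unfolded. [folklore] -/
theorem truncRec_succ (g : ℕ → ℝ) (n : ℕ) (U : Bg) (X : C.Dom) :
    truncRec base T Ψ g (n + 1) U X =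
      if C.scale X ≤ n then truncRec base T Ψ g n U X
      else if C.scale X = n + 1 then Ψ n (g n) (T n g (truncRec base T Ψ g n)) U X else 0 := rfl

/-- The action after `n` steps has no term of creation step `> n`. [folklore] -/
theorem truncRec_of_lt (g : ℕ → ℝ) {n : ℕ} {U : Bg} {X : C.Dom} (h : n < C.scale X) :
    truncRec base T Ψ g n U X = 0 := by
  induction n with
  | zero => rw [truncRec_zero, if_neg (by omega)]
  | succ n ih => rw [truncRec_succ, if_neg (by omega), if_neg (by omega)]

/-- STABILITY: below the truncation level the collections agree — a term, once created, is fixed ((0.23): «in the old only a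
background field is changed»). [folklore] -/
theorem truncRec_mono (g : ℕ → ℝ) {m n : ℕ} (hmn : m ≤ n) {U : Bg} {X : C.Dom} (hX : C.scale X ≤ m) :
    truncRec base T Ψ g n U X = truncRec base T Ψ g m U X := by
  induction n with
  | zero =>
    have hm : m = 0 := Nat.le_zero.1 hmn
    subst hm; rfl
  | succ n ih =>
    rcases Nat.lt_or_eq_of_le hmn with hlt | heq
    · rw [truncRec_succ, if_pos (by omega)]
      exact ih (by omega)
    · subst heq; rfl

/-- The functional on a domain of creation step `≤ n` is read off the action after `n` steps. [folklore] -/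
theorem recE_eq_truncRec (g : ℕ → ℝ) {n : ℕ} {U : Bg} {X : C.Dom} (hX : C.scale X ≤ n) :
    recE base T Ψ g U X = truncRec base T Ψ g n U X :=
  (truncRec_mono g hX le_rfl).symm

/-- **THE TRUNCATION OF THE FUNCTIONAL IS THE ACTION AFTER `n` STEPS**: `truncScale n (recE g) = truncRec g n`. [folklore] -/
theorem truncScale_recE (g : ℕ → ℝ) (n : ℕ) :
    truncScale n (recE base T Ψ g) = truncRec base T Ψ g n := by
  funext U X
  by_cases hX : C.scale X ≤ n
  · rw [truncScale, if_pos hX, recE_eq_truncRec g hX]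
  · rw [truncScale, if_neg hX, truncRec_of_lt g (by omega)]

/-- On creation step 0 the functional is the scale-0 datum (history-free). [folklore] -/
theorem recE_zero (g : ℕ → ℝ) {U : Bg} {X : C.Dom} (hX : C.scale X = 0) : recE base T Ψ g U X = base U X := by
  rw [recE, hX, truncRec_zero, if_pos hX]

/-- On creation step `k + 1` the functional is the new-term map at the last coupling `g k` and the step-k channel output of the
action after `k` steps — the FORM of (2.13) p. 268. [cite: Balaban1987RG1, (2.13) p.268] -/
theorem recE_succ (g : ℕ → ℝ) {k : ℕ} {U : Bg} {X : C.Dom} (hX : C.scale X = k + 1) :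
    recE base T Ψ g U X = Ψ k (g k) (T k g (truncRec base T Ψ g k)) U X := by
  rw [recE, hX, truncRec_succ, if_neg (by omega), if_pos hX]

/-! ## §2 The structure binders PROVED for the recursion-defined functional -/

/-- **`ScaleZeroFree` BY CONSTRUCTION** (any window). [folklore] -/
theorem scaleZeroFree_recE (W : Set (ℕ → ℝ)) : ScaleZeroFree (recE base T Ψ) W := by
  intro g _ g' _ U X hX
  rw [recE_zero g hX, recE_zero g' hX]

/-- **`Factorises` BY CONSTRUCTION** for a channel that reads only the action after `k` steps — locality stated for ALL
collections (`T k s H = T k s (truncScale k H)`; [II] (1.33) p. 9 localizes the action 𝐄_k after k steps). [cite: Balaban1988RG2Cluster, (1.33) p.9] -/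
theorem factorises_recE (W : Set (ℕ → ℝ))
    (hloc : ∀ (k : ℕ) (s : ℕ → ℝ) (H : Bg → C.Dom → ℝ) (y : ι), T k s H y = T k s (truncScale k H) y) :
    Factorises (recE base T Ψ) W T Ψ := by
  intro g _ k U X hX
  rw [recE_succ g hX]
  have hT : T k g (recE base T Ψ g) = T k g (truncRec base T Ψ g k) := by
    funext y; rw [hloc, truncScale_recE]
  rw [hT]

/-- **`Factorises` BY CONSTRUCTION, admissible-class form**: the lineage's binder `ChannelLocal Adm T` + admissibility of the
window's collections suffice. [folklore] -/
theorem factorises_recE_of_channelLocal {W : Set (ℕ → ℝ)} {Adm : Set (Bg → C.Dom → ℝ)} (hloc : ChannelLocal Adm T)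
    (hAdm : ∀ g ∈ W, recE base T Ψ g ∈ Adm) : Factorises (recE base T Ψ) W T Ψ := by
  intro g hg k U X hX
  rw [recE_succ g hX]
  have hT : T k g (recE base T Ψ g) = T k g (truncRec base T Ψ g k) := by
    funext y; rw [hloc k g _ (hAdm g hg) y, truncScale_recE]
  rw [hT]

/-- **PREFIX DEPENDENCE BY CONSTRUCTION** ([I] p. 256 «The function 𝐄_k depends also on the effective coupling constants g_0, …,
g_{k−1}»): if the step-k channel reads the comparison history only through `s_0, …, s_k` (CAUSALITY — in print only through
`s_k`, via B′ = g_kCB − hD̃(g_kCB), (2.12) p. 268), then two histories agreeing below `n` have the same action after `n` steps,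
hence the same terms of creation step `≤ n`. [cite: Balaban1987RG1, §0 p.256 and (2.12) p.268] -/
theorem truncRec_eq_of_agree
    (hT : ∀ (k : ℕ) (s s' : ℕ → ℝ) (H : Bg → C.Dom → ℝ) (y : ι), (∀ i ≤ k, s i = s' i) → T k s H y = T k s' H y)
    {g g' : ℕ → ℝ} {n : ℕ} (hagree : ∀ i < n, g i = g' i) :
    truncRec base T Ψ g n = truncRec base T Ψ g' n := by
  induction n with
  | zero => rfl
  | succ n ih =>
    have ihn : truncRec base T Ψ g n = truncRec base T Ψ g' n := ih fun i hi => hagree i (by omega)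
    funext U X
    rw [truncRec_succ, truncRec_succ, ihn, hagree n (by omega)]
    have hTT : T n g (truncRec base T Ψ g' n) = T n g' (truncRec base T Ψ g' n) := by
      funext y; exact hT n g g' _ y fun i hi => hagree i (by omega)
    rw [hTT]

/-- **`T4OutputRate.PrefixDependenceOn` BY CONSTRUCTION** for a causal channel (any window). [cite: Balaban1987RG1, §0 p.256] -/
theorem prefixDependenceOn_recE (W : Set (ℕ → ℝ))
    (hT : ∀ (k : ℕ) (s s' : ℕ → ℝ) (H : Bg → C.Dom → ℝ) (y : ι), (∀ i ≤ k, s i = s' i) → T k s H y = T k s' H y) :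
    PrefixDependenceOn (recE base T Ψ) W := by
  intro g _ g' _ U X hagree
  simp only [recE]
  rw [truncRec_eq_of_agree hT hagree]

/-! ## §3 Uniqueness: `Factorises` + scale-0 data + a local channel DETERMINE the functional -/

/-- For a functional with `Factorises E W T Ψ`, scale-0 values `base`, and a channel reading only `truncScale k`, the action
after `n` steps of every window history is `truncRec base T Ψ g n` (induction on `n`). [folklore] -/
theorem truncScale_eq_truncRec_of_factorises {E : Functional C Bg} {W : Set (ℕ → ℝ)} (hfac : Factorises E W T Ψ)
    (hbase : ∀ g ∈ W, ∀ (U : Bg) (X : C.Dom), C.scale X = 0 → E g U X = base U X)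
    (hloc : ∀ (k : ℕ) (s : ℕ → ℝ) (H : Bg → C.Dom → ℝ) (y : ι), T k s H y = T k s (truncScale k H) y)
    {g : ℕ → ℝ} (hg : g ∈ W) : ∀ n : ℕ, truncScale n (E g) = truncRec base T Ψ g n
  | 0 => by
    funext U X
    rw [truncRec_zero]
    by_cases hX : C.scale X = 0
    · rw [truncScale, if_pos hX.le, if_pos hX, hbase g hg U X hX]
    · rw [truncScale, if_neg (by omega), if_neg hX]
  | n + 1 => by
    have ih := truncScale_eq_truncRec_of_factorises hfac hbase hloc hg n
    funext U X
    rw [truncRec_succ]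
    by_cases h1 : C.scale X ≤ n
    · rw [truncScale, if_pos (by omega), if_pos h1, ← ih, truncScale, if_pos h1]
    · by_cases h2 : C.scale X = n + 1
      · rw [truncScale, if_pos h2.le, if_neg h1, if_pos h2, hfac g hg n U X h2]
        have hT : T n g (E g) = T n g (truncRec base T Ψ g n) := by
          funext y; rw [hloc, ih]
        rw [hT]
      · rw [truncScale, if_neg (by omega), if_neg h1, if_neg h2]

/-- **UNIQUENESS OF THE RECURSION-DEFINED FUNCTIONAL (kernel)**: on the window, a functional that FACTORISES through
`(T, Ψ)`, takes the scale-0 values `base`, with a channel reading only the action after `k` steps, IS `recE base T Ψ`.  So the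
END's binder `Factorises` is a DEFINITION, not a constraint: the whole family is determined by (base, T, Ψ). [folklore] -/
theorem eq_recE_of_factorises {E : Functional C Bg} {W : Set (ℕ → ℝ)} (hfac : Factorises E W T Ψ)
    (hbase : ∀ g ∈ W, ∀ (U : Bg) (X : C.Dom), C.scale X = 0 → E g U X = base U X)
    (hloc : ∀ (k : ℕ) (s : ℕ → ℝ) (H : Bg → C.Dom → ℝ) (y : ι), T k s H y = T k s (truncScale k H) y)
    {g : ℕ → ℝ} (hg : g ∈ W) (U : Bg) (X : C.Dom) : E g U X = recE base T Ψ g U X := by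
  have h := congrFun (congrFun (truncScale_eq_truncRec_of_factorises hfac hbase hloc hg (C.scale X)) U) X
  rw [truncScale, if_pos le_rfl] at h
  exact h

/-! ## §4 Non-vacuity: the tree witness is a recursion-defined functional -/

section Witness

variable (ν N : ℕ)

/-- The witness channel `wT k s H _ = Σ_{j ≤ k} (½)^{k−j}·H () (refDom j)` reads only reference domains of creation step `≤ k`,
hence only `truncScale k H` (locality for all collections). [folklore] -/
theorem wT_local (k : ℕ) (s : ℕ → ℝ) (H : Unit → (torusCarriers ν N).Dom → ℝ) (y : Unit) :
    wT ν N k s H y = wT ν N k s (truncScale k H) y := by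
  simp only [wT]
  refine Finset.sum_congr rfl fun j hj => ?_
  have hjk : j ≤ k := Nat.lt_succ_iff.1 (Finset.mem_range.1 hj)
  have hle : (torusCarriers ν N).scale (refDom ν N j) ≤ k := by rw [scale_refDom]; exact hjk
  rw [truncScale, if_pos hle]

/-- **THE WITNESS FUNCTIONAL IS `recE 0 wT wΨ`** (kernel): `T4HistoryLipschitzWitness.wE` factorises (`w_factorises`), vanishes on
creation step 0 (`wE_zero`) and its channel is local (`wT_local`), so by uniqueness it is the recursion-defined functional with
zero scale-0 data — on ANY window. [folklore] -/
theorem wE_eq_recE (W : Set (ℕ → ℝ)) {g : ℕ → ℝ} (hg : g ∈ W) (U : Unit) (X : (torusCarriers ν N).Dom) :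
    wE ν N g U X = recE (fun _ _ => (0 : ℝ)) (wT ν N) (wΨ ν N) g U X :=
  eq_recE_of_factorises (w_factorises ν N W) (fun g _ U X hX => wE_zero ν N g U X hX) (wT_local ν N) hg U X

/-- Consequently the witness has PREFIX DEPENDENCE by construction (its channel does not read the comparison history at all).
[folklore] -/
theorem w_prefixDependence (W : Set (ℕ → ℝ)) : PrefixDependenceOn (C := torusCarriers ν N) (wE ν N) W := by
  intro g hg g' hg' U X hagree
  rw [wE_eq_recE ν N W hg, wE_eq_recE ν N W hg']
  exact prefixDependenceOn_recE (base := fun _ _ => (0 : ℝ)) (T := wT ν N) (Ψ := wΨ ν N) W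
    (fun _ _ _ _ _ _ => rfl) g hg g' hg' U X hagree

end Witness

end Summit.QuantumFields.BalabanUV.T4Continuum.NE9RecursionFunctional

end
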